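import Mathlib
import HarnessLib
import Literature.Analysis.FluidPDE.TaoAveragedJointWeightProofsAt
import Literature.Analysis.FluidPDE.TaoAveragedSingleScaleAtOfJointWeight
import Literature.Analysis.FluidPDE.TaoAveragedSingleScaleRotation
import Summits.NavierStokesRegularity.NavierStokesRegularity.Theses.TaoLadderRungOne

/-!
# Route TaoLadderRungOne — crux `SingleScaleNoDilAt` (stmt-NavierStokesRegularity-20473): Tao's
# single-scale identity (3.9)/(3.13) WITHOUT DILATION AVERAGING about every closed base triangle with
# sides in `[4/5, 3/2]` and an input-modulus gap (proved)

**Statement (route decl, verbatim).** For every `κ > 0` there is `ε₁ > 0` such that for all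
`0 < ε₀ ≤ ε₁`, every closed base triple `ξ` (`ξ 0 + ξ 1 + ξ 2 = 0`) with `4/5 ≤ ‖ξ j‖ ≤ 3/2` and
`κ ε₀ ≤ |‖ξ 0‖ - ‖ξ 1‖|`, and all profiles `ψ` normalised about `ξ` (`ψ̂ⱼ ⊆ B̄(ξ j, ε₀³)`), the
single-scale form `C₀ = ⟨u,ψ̄₁⟩⟨v,ψ̄₂⟩⟨w,ψ̄₃⟩` (`singleScaleForm`) is a DILATION-FREE complex average
(`IsComplexAverageNoDilOf`, Def. 3.4 with `λ ≡ 1`) of the single-scale target `B_{η,ρ,0;ξ}`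
(`betaRhoZeroFormAt ξ ε₀`).

HONEST FRAMING: a MODEL statement about T. Tao's averaged Navier–Stokes construction (J. Amer. Math.
Soc. 29 (2016) = arXiv:1402.0290, §3.5–3.9 and Remark 3.5: "The averaging over dilation operators
was only needed to place the base frequencies … where the non-degeneracy condition (3.24) held. This
condition in fact holds for generic `ξ⁰₁, ξ⁰₂, ξ⁰₃`"), rung `M_1` of the cell harvest/h2-tao-ladder's
ladder; nothing here concerns the true Navier–Stokes equations.

**Proof** (threshold `ε₁(κ) = min 10⁻⁴ (κ/24000)`):
* every closed triple with sides in `[4/5, 3/2]` is `S ∘ ζ` for a linear isometry `S` and a FRAME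
  triple `ζ` (plane `z = 0`, `ζ 2 ∥ e₀`, positively oriented: `exists_isometry_frameTriple`,
  `TaoAveragedFrameTriples.lean`), and the sentence is covariant under common rotations
  (`singleScaleAt_isComplexAverageNoDil_rotate`); the gap transfers (`‖ζ j‖ = ‖ξ j‖`);
* about the frame triple `ζ`: the non-degeneracy (3.24) holds for every closed `η` within
  `δ = min (1/100) (κ ε₀/4)` of `ζ` (`nondegWithin_of_gap`: Remark 3.5 made quantitative — the
  radius is linear in the input gap, no implicit function theorem), and `5500 ε₀³ < δ` for
  `ε₀ ≤ ε₁(κ)`;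
* hence §3.6–3.9 re-run about `ζ` (`jointWeight_identity_frameTriple`,
  `TaoAveragedJointWeightProofsAt.lean`: quaternion coordinates, rotation disintegration, torus
  averaging, fibre synthesis; localisation `near_base_of_cutoffs` with constants uniform over the
  window) gives joint-weight data `(d, μ₀, E, F)` reproducing `∏ⱼ ∫ Xⱼ · \overline{ψ̂ⱼ}`;
* §3.5 + §3.6 (plane-wave synthesis) about `ζ`: `singleScaleAt_isComplexAverageNoDil_of_jointWeightAt`.
-/

-- the sub-problem namespace `Summit.NavierStokesRegularity.NavierStokesRegularity` repeats the summit name by design (D-0017)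
set_option linter.dupNamespace false

namespace Summit.NavierStokesRegularity.NavierStokesRegularity.Theorems

open MeasureTheory FourierTransform
open Literature.Analysis.FluidPDE.Tao2016
open Summit.NavierStokesRegularity.NavierStokesRegularity.Theses.TaoLadderRungOne

/-- **The single-scale step about a FRAME triple with (3.24) in a radius `δ > 5500 ε₀³`**: for
`0 < ε₀ ≤ 10⁻⁴`, `C₀` is a dilation-free complex average of `B_{η,ρ,0;ζ}` for all profiles normalised
about `ζ` (§3.6–3.9 about `ζ`, then §3.5–3.6). [cite: Tao2016AveragedNS, §3.5–3.9 (3.9), (3.13), (3.24); Remark 3.5 p. 20] -/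
theorem taoLadderRungOne_singleScaleNoDilAt_frame {ζ : Fin 3 → EuclideanSpace ℝ (Fin 3)} {ε₀ δ : ℝ}
    (hζ : IsFrameTriple ζ) (hε₀ : 0 < ε₀) (hε1 : ε₀ ≤ 1 / 10000) (hnd : NondegWithin ζ δ)
    (hδ : 5500 * ε₀ ^ 3 < δ)
    (φ : Fin 3 → SchwartzMap (EuclideanSpace ℝ (Fin 3)) (EuclideanSpace ℂ (Fin 3)))
    (hφ : NormalisedProfilesAt ζ ε₀ φ) :
    IsComplexAverageNoDilOf (singleScaleForm (φ 0) (φ 1) (φ 2)) (betaRhoZeroFormAt ζ ε₀) := by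
  obtain ⟨d, μ₀, hμ₀, E, hE, F, hF, hFc, hid⟩ := jointWeight_identity_frameTriple hζ hε₀ hε1 hnd hδ φ hφ
  haveI := hμ₀
  exact singleScaleAt_isComplexAverageNoDil_of_jointWeightAt ζ ε₀ φ μ₀ hE hF hFc hid

/-- **Crux `SingleScaleNoDilAt` (stmt-NavierStokesRegularity-20473), proved** with
`ε₁(κ) = min 10⁻⁴ (κ/24000)`: reduction to a frame triple by a common rotation, (3.24) within
`min (1/100) (κ ε₀/4)` of it, the joint-weight identity about the frame triple, and the §3.5–3.6
reduction. MODEL statement (Tao's averaged equation); nothing about the true Navier–Stokes equations.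
[cite: Tao2016AveragedNS, §3.2 (3.7) p. 15, §3.5–3.9 (3.9)–(3.24) pp. 17–20, Remark 3.5 p. 20] -/
theorem taoLadderRungOne_singleScaleNoDilAt_proof : SingleScaleNoDilAt := by
  intro κ hκ
  refine ⟨min (1 / 10000) (κ / 24000), by positivity, fun ε₀ hε₀ hle ξ hsum hwin hgap ψ hψ => ?_⟩
  have hε1 : ε₀ ≤ 1 / 10000 := hle.trans (min_le_left _ _)
  have hεκ : ε₀ ≤ κ / 24000 := hle.trans (min_le_right _ _)
  -- reduction to a frame triple
  obtain ⟨S, ζ, hζ, hS⟩ := exists_isometry_frameTriple ξ hsum hwin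
  have hξ : ξ = fun j => S (ζ j) := funext hS
  have hnorm : ∀ j, ‖ζ j‖ = ‖ξ j‖ := fun j => by rw [hS j, LinearIsometryEquiv.norm_map]
  have hgap' : κ * ε₀ ≤ |‖ζ 0‖ - ‖ζ 1‖| := by rw [hnorm 0, hnorm 1]; exact hgap
  -- (3.24) within `δ = min (1/100) (κ ε₀ / 4)` of `ζ`, and `5500 ε₀³ < δ`
  have hnd := nondegWithin_of_gap ζ hζ.window hκ hε₀ hgap'
  have hδ : 5500 * ε₀ ^ 3 < min (1 / 100) (κ * ε₀ / 4) := by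
    refine lt_min ?_ ?_
    · have : ε₀ ^ 3 ≤ (1 / 10000) ^ 3 := by gcongr
      linarith
    · have hsq : ε₀ * ε₀ ≤ κ / 24000 * (1 / 10000) := mul_le_mul hεκ hε1 hε₀.le (by positivity)
      have hκε : 0 < κ * ε₀ := mul_pos hκ hε₀
      have h3 : ε₀ ^ 3 = ε₀ * ε₀ * ε₀ := by ring
      rw [h3]
      nlinarith
  -- the sentence about `ζ`, then about `ξ = S ∘ ζ`
  have hframe : ∀ φ : Fin 3 → SchwartzMap (EuclideanSpace ℝ (Fin 3)) (EuclideanSpace ℂ (Fin 3)),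
      NormalisedProfilesAt ζ ε₀ φ →
        IsComplexAverageNoDilOf (singleScaleForm (φ 0) (φ 1) (φ 2)) (betaRhoZeroFormAt ζ ε₀) :=
    fun φ hφ => taoLadderRungOne_singleScaleNoDilAt_frame hζ hε₀ hε1 hnd hδ φ hφ
  have h := singleScaleAt_isComplexAverageNoDil_rotate S hframe ψ (by rw [← hξ]; exact hψ)
  rw [← hξ] at h
  exact h

end Summit.NavierStokesRegularity.NavierStokesRegularity.Theorems
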